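import Summits.QuantumFields.YangMills.Theorems.LuscherReductionDressedRitzOfGenerators
import Summits.QuantumFields.YangMills.Theorems.LuscherReductionDressedRitzRitzNearDiagonal
import HarnessLib

/-!
# Route `LuscherReduction`, item `DressedRitz` (stmt-QuantumFields-20205) — reduction chain, file 2:
# `DiagonalPlateauAt k → RitzGeneratorsAt k → DressedRitzAt k` — the GEVP-free generator cut (LEMMA B + pure-real repackaging)

Support module of the `FemtoTransferGap` group (fleet service by seat ym-infvol-p2 g6; route `LuscherReduction`, femto rung R2b1; bears on the
crux child `DressedRitz` = stmt-QuantumFields-20205 of RED stmt-QuantumFields-19978).  CONTENT = §7 of the planner's crux workfile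
`Summits/QuantumFields/YangMills/Cruxes/RunningReduction/Lines/DressedRitzGEVP.lean` (rev 3, sha16 8eae6de8b30412fb, seat ym-cruxidea-19978-1
GEN 4; kernel-checked there) RE-HOMED on the Theorems side LEVEL BY LEVEL (cuts ↦ their `k`-slices of `…DressedRitzPlateauDefs.lean`, proofs
VERBATIM minus the leading `intro k`).

Every hypothesis of `DiagonalPlateauAt k` is ONE NUMBER per pair of generators and Euclidean time `r ∈ {0,1,2}`; LEMMA B (`ritz_near_diagonal`,
file B) turns it into (g3), the rest of `RitzGeneratorsAt k` is bookkeeping — NO eigenvalue problem is left to the prover of the cut.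
* `twoSided_of_additive` — pure real: additive Ritz errors + two-sided DIAGONAL position ⇒ two-sided RITZ position, constant `C + 5C₁`.
* ★ `ritzGeneratorsAt_of_diagonalPlateauAt : DiagonalPlateauAt k → RitzGeneratorsAt k` (LEMMA B in the physical subspace with `ε = C'λ`,
  `τ = C'(λ²/L)d₀`, `σ = C'(λ/L)d₀`; constants `C' = max C 1`, `C₁ = 2(2nC' + 4n²C'³)`, output `C' + 5C₁`, `lam0' = min lam0 (1/(8nC'(C₁+1)))`).
* `dressedRitzAt_of_diagonalPlateauAt`, ★ `dressedRitz_of_diagonalPlateau : (∀ k, DiagonalPlateauAt k) → Theses.LuscherReduction.DressedRitz`.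
HONEST FRAMING: fixed-lattice Rayleigh–Ritz ∕ GEVP bookkeeping on the femto rung R2b1; proves nothing OF `DressedRitz`; no bearing on infinite
volume, the continuum limit or the Clay mass gap.  References: Lüscher–Wolff (GEVP) [cite: LuscherWolff1990]; Golub–Van Loan §8.1
[cite: GolubVanLoan2013, §8.1.1]; Reed–Simon IV XIII.1–2 [cite: ReedSimonIV1978, XIII.1].
-/

set_option autoImplicit false

noncomputable section

open MeasureTheory Filter Topology Real
open Literature.MathematicalPhysics.QuantumFieldTheory
open Literature.MathematicalPhysics.QuantumLattice
open Literature.Analysis.OperatorTheory.YMMatrixModel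
open Literature.Analysis.OperatorTheory
open Literature.Analysis.OperatorTheory.ClusterKatoTemple
open scoped BigOperators

namespace Summit.QuantumFields.YangMills.Theorems.FemtoTransferGap.KTGen

open Summit.QuantumFields.YangMills.Theorems.FemtoTransferGap
open Summit.QuantumFields.YangMills.Theorems.FemtoTransferGap.KTRCalibration
open Summit.QuantumFields.YangMills.Theorems.FemtoTransferGap.PhysL2

/-! ## §7 `DiagonalPlateauAt k → RitzGeneratorsAt k` -/

/-- Pure-real repackaging: additive Ritz errors `|R − d| ≤ δ ≤ C₁·y·d₀` plus the two-sided DIAGONAL position give the two-sided RITZ position with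
constant `C + 5C₁` (uses `1 + z ≤ e^z` and `(1 − z)(1 + 2z) ≥ 1` on `[0, 1/2]`; no division). [folklore] -/
theorem twoSided_of_additive {Rj R0 dj d0 μj μ0 δ y C C₁ : ℝ}
    (hy : 0 ≤ y) (hC₁ : 0 ≤ C₁) (hsmall : 2 * C₁ * y ≤ 1 / 2)
    (hμj : 0 ≤ μj) (hμ0 : 0 ≤ μ0) (hdj : 0 ≤ dj) (hd0 : 0 ≤ d0) (hRj : 0 ≤ Rj)
    (hRdj : |Rj - dj| ≤ δ) (hRd0 : |R0 - d0| ≤ δ) (hδ : δ ≤ C₁ * y * d0) (hd0R0 : d0 ≤ R0)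
    (hd0dj : d0 ≤ 2 * dj)
    (h1 : dj * μ0 ≤ Real.exp (C * y) * (μj * d0)) (h2 : μj * d0 ≤ Real.exp (C * y) * (dj * μ0)) :
    Rj * μ0 ≤ Real.exp ((C + 5 * C₁) * y) * (μj * R0) ∧
      μj * R0 ≤ Real.exp ((C + 5 * C₁) * y) * (Rj * μ0) := by
  have hC₁y : 0 ≤ C₁ * y := mul_nonneg hC₁ hy
  have hδ' : δ ≤ 2 * C₁ * y * dj := hδ.trans (by nlinarith)
  obtain ⟨hRlo, hRhi⟩ := abs_le.mp hRdj
  obtain ⟨hR0lo, hR0hi⟩ := abs_le.mp hRd0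
  have e1 : 1 + C₁ * y ≤ Real.exp (C₁ * y) := by linarith [Real.add_one_le_exp (C₁ * y)]
  have e2 : 1 + 2 * C₁ * y ≤ Real.exp (2 * C₁ * y) := by linarith [Real.add_one_le_exp (2 * C₁ * y)]
  have e4 : 1 + 4 * C₁ * y ≤ Real.exp (4 * C₁ * y) := by linarith [Real.add_one_le_exp (4 * C₁ * y)]
  constructor
  · have s1 : Rj * μ0 ≤ (1 + 2 * C₁ * y) * (dj * μ0) := by
      have : Rj ≤ (1 + 2 * C₁ * y) * dj := by nlinarith
      calc Rj * μ0 ≤ ((1 + 2 * C₁ * y) * dj) * μ0 := mul_le_mul_of_nonneg_right this hμ0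
        _ = _ := by ring
    have s2 : (1 + 2 * C₁ * y) * (dj * μ0) ≤ Real.exp (2 * C₁ * y) * (dj * μ0) :=
      mul_le_mul_of_nonneg_right e2 (mul_nonneg hdj hμ0)
    have s3 : Real.exp (2 * C₁ * y) * (dj * μ0) ≤ Real.exp (2 * C₁ * y) * (Real.exp (C * y) * (μj * d0)) :=
      mul_le_mul_of_nonneg_left h1 (Real.exp_pos _).le
    have s4 : μj * d0 ≤ μj * R0 := mul_le_mul_of_nonneg_left hd0R0 hμj
    have s5 : Real.exp (2 * C₁ * y) * Real.exp (C * y) ≤ Real.exp ((C + 5 * C₁) * y) := by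
      rw [← Real.exp_add]
      exact Real.exp_le_exp.mpr (by nlinarith)
    calc Rj * μ0 ≤ (1 + 2 * C₁ * y) * (dj * μ0) := s1
      _ ≤ Real.exp (2 * C₁ * y) * (dj * μ0) := s2
      _ ≤ Real.exp (2 * C₁ * y) * (Real.exp (C * y) * (μj * d0)) := s3
      _ = (Real.exp (2 * C₁ * y) * Real.exp (C * y)) * (μj * d0) := by ring
      _ ≤ Real.exp ((C + 5 * C₁) * y) * (μj * R0) :=
          mul_le_mul s5 s4 (mul_nonneg hμj hd0) (Real.exp_pos _).le
  · have t1 : μj * R0 ≤ (1 + C₁ * y) * (μj * d0) := by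
      have : R0 ≤ (1 + C₁ * y) * d0 := by nlinarith
      calc μj * R0 ≤ μj * ((1 + C₁ * y) * d0) := mul_le_mul_of_nonneg_left this hμj
        _ = _ := by ring
    have t2 : (1 + C₁ * y) * (μj * d0) ≤ Real.exp (C₁ * y) * (μj * d0) :=
      mul_le_mul_of_nonneg_right e1 (mul_nonneg hμj hd0)
    have t3 : Real.exp (C₁ * y) * (μj * d0) ≤ Real.exp (C₁ * y) * (Real.exp (C * y) * (dj * μ0)) :=
      mul_le_mul_of_nonneg_left h2 (Real.exp_pos _).le
    -- `dj ≤ (1 + 4C₁y) Rj` without division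
    have hz : dj * (1 - 2 * C₁ * y) ≤ Rj := by nlinarith
    have h14 : 0 ≤ 1 + 4 * C₁ * y := by nlinarith
    have t4 : dj ≤ (1 + 4 * C₁ * y) * Rj := by
      have hz0 : 0 ≤ 2 * C₁ * y := by nlinarith
      have hz1 : 0 ≤ 1 - 2 * (2 * C₁ * y) := by linarith
      have hprod : 1 ≤ (1 - 2 * C₁ * y) * (1 + 4 * C₁ * y) := by nlinarith [mul_nonneg hz0 hz1]
      calc dj = dj * 1 := (mul_one _).symm
        _ ≤ dj * ((1 - 2 * C₁ * y) * (1 + 4 * C₁ * y)) := mul_le_mul_of_nonneg_left hprod hdj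
        _ = (dj * (1 - 2 * C₁ * y)) * (1 + 4 * C₁ * y) := by ring
        _ ≤ Rj * (1 + 4 * C₁ * y) := mul_le_mul_of_nonneg_right hz h14
        _ = (1 + 4 * C₁ * y) * Rj := mul_comm _ _
    have t5 : dj * μ0 ≤ Real.exp (4 * C₁ * y) * (Rj * μ0) := by
      calc dj * μ0 ≤ ((1 + 4 * C₁ * y) * Rj) * μ0 := mul_le_mul_of_nonneg_right t4 hμ0
        _ ≤ (Real.exp (4 * C₁ * y) * Rj) * μ0 :=
            mul_le_mul_of_nonneg_right (mul_le_mul_of_nonneg_right e4 hRj) hμ0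
        _ = _ := by ring
    have t6 : Real.exp (C₁ * y) * Real.exp (C * y) * Real.exp (4 * C₁ * y) = Real.exp ((C + 5 * C₁) * y) := by
      rw [← Real.exp_add, ← Real.exp_add]
      congr 1
      ring
    calc μj * R0 ≤ (1 + C₁ * y) * (μj * d0) := t1
      _ ≤ Real.exp (C₁ * y) * (μj * d0) := t2
      _ ≤ Real.exp (C₁ * y) * (Real.exp (C * y) * (dj * μ0)) := t3
      _ = (Real.exp (C₁ * y) * Real.exp (C * y)) * (dj * μ0) := by ring
      _ ≤ (Real.exp (C₁ * y) * Real.exp (C * y)) * (Real.exp (4 * C₁ * y) * (Rj * μ0)) :=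
          mul_le_mul_of_nonneg_left t5 (by positivity)
      _ = Real.exp ((C + 5 * C₁) * y) * (Rj * μ0) := by rw [← t6]; ring

set_option maxHeartbeats 1600000 in
/-- ★ **`DiagonalPlateauAt k → RitzGeneratorsAt k`** (hence `→ DressedRitzAt k`): LEMMA B (`ritz_near_diagonal`) in the physical subspace with
`ε = C'λ`, `τ = C'(λ²/L)d₀`, `σ = C'(λ/L)d₀` gives `|ritzValue_j − d_j| ≤ C₁(λ²/L)d₀`; `twoSided_of_additive` converts to (g3); (g1) is the Gram
lower bound, (g2)/(g4) use `d₀ ≤ ritzValue₀`.  Constants: `C' = max C 1`, `C₁ = 2(2nC' + 4n²C'³)`, output `C' + 5C₁`, `lam0' = min lam0 (1/(8nC'(C₁+1)))`. [cite: LuscherWolff1990] -/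
theorem ritzGeneratorsAt_of_diagonalPlateauAt {k : ℕ} (h : DiagonalPlateauAt k) : RitzGeneratorsAt k := by
  intro η hη
  obtain ⟨C, lam0, hlam0, hC⟩ := h η hη
  -- constants
  set n : ℝ := (k : ℝ) + 1 with hndef
  have hn1 : 1 ≤ n := by rw [hndef]; have := (Nat.cast_nonneg k : (0 : ℝ) ≤ k); linarith
  have hn0 : 0 ≤ n := zero_le_one.trans hn1
  have hncast : ((k + 1 : ℕ) : ℝ) = n := by rw [hndef]; push_cast; ring
  set C' : ℝ := max C 1 with hC'def
  have hC'1 : 1 ≤ C' := le_max_right C 1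
  have hC'0 : 0 ≤ C' := zero_le_one.trans hC'1
  have hCC' : C ≤ C' := le_max_left C 1
  set C₁ : ℝ := 2 * (2 * n * C' + 4 * n ^ 2 * C' ^ 3) with hC₁def
  have hC₁0 : 0 ≤ C₁ := by rw [hC₁def]; positivity
  set CR : ℝ := C' + 5 * C₁ with hCRdef
  have hC'CR : C' ≤ CR := by rw [hCRdef]; linarith
  have hCCR : C ≤ CR := hCC'.trans hC'CR
  set M : ℝ := 4 * n * C' * (C₁ + 1) with hMdef
  have hM4 : 4 ≤ M := by
    rw [hMdef]
    have h1 : 1 ≤ n * C' := by nlinarith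
    have h2 : 1 ≤ C₁ + 1 := by linarith
    nlinarith [mul_le_mul h1 h2 zero_le_one (by positivity)]
  have hM0 : 0 < M := by linarith
  set lam1 : ℝ := min lam0 (1 / (2 * M)) with hlam1def
  have hlam1 : 0 < lam1 := lt_min hlam0 (by positivity)
  refine ⟨CR, lam1, hlam1, fun lam hlam hle => ?_⟩
  obtain ⟨L0, hL0⟩ := hC lam hlam (hle.trans (min_le_left _ _))
  refine ⟨L0, fun L _ hL β hW => ?_⟩
  obtain ⟨v, hphys, hnorm, hsort, hoff, hres, hpos, hcoup, hspread, htop⟩ := hL0 L hL β hW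
  have hβ1 : (1 : ℝ) ≤ β := hW.1
  have hβ0 : (0 : ℝ) ≤ β := zero_le_one.trans hβ1
  -- the slow coordinate `x = λ` and its smallness
  set x : ℝ := luscherLambda β L with hxdef
  have hx0 : 0 ≤ x := luscherLambda_nonneg β L
  have hxlam : x ≤ 2 * lam := hW.2.2
  have hxM : x * M ≤ 1 := by
    have h1 : lam ≤ 1 / (2 * M) := hle.trans (min_le_right _ _)
    have h2 : x ≤ 1 / M := by
      calc x ≤ 2 * lam := hxlam
        _ ≤ 2 * (1 / (2 * M)) := by linarith
        _ = 1 / M := by field_simp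
    have := (le_div_iff₀ hM0).mp h2
    linarith
  have hx1 : x ≤ 1 := by nlinarith
  have hnCx : n * C' * x ≤ 1 / 4 := by
    have : 4 * (n * C' * x) * (C₁ + 1) = x * M := by rw [hMdef]; ring
    nlinarith [mul_nonneg (mul_nonneg hn0 hC'0) hx0]
  have hC'x : C' * x ≤ 1 / 4 := by nlinarith [mul_nonneg hC'0 hx0]
  have hC₁x : C₁ * x ≤ 1 / 4 := by
    have h1 : 4 * (C₁ * x) ≤ 4 * ((C₁ + 1) * x) := by nlinarith
    have h2 : 4 * ((C₁ + 1) * x) ≤ 4 * ((C₁ + 1) * x) * (n * C') := by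
      have : 1 ≤ n * C' := by nlinarith
      nlinarith [mul_nonneg (by linarith : (0:ℝ) ≤ C₁ + 1) hx0]
    have h3 : 4 * ((C₁ + 1) * x) * (n * C') = x * M := by rw [hMdef]; ring
    nlinarith
  have hL1 : (1 : ℝ) ≤ (L : ℝ) := by exact_mod_cast Nat.one_le_iff_ne_zero.mpr (NeZero.ne L)
  have hL0' : (0 : ℝ) < (L : ℝ) := by linarith
  set y : ℝ := x ^ 2 / (L : ℝ) with hydef
  have hy0 : 0 ≤ y := div_nonneg (sq_nonneg _) hL0'.le
  have hyx : y ≤ x := by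
    rw [hydef, div_le_iff₀ hL0']
    nlinarith
  have hx3 : 0 ≤ x ^ 3 / (L : ℝ) ^ 2 := div_nonneg (pow_nonneg hx0 3) (sq_nonneg _)
  -- packaged family, forms
  let V : Fin (k + 1) → physSubmodule L := fun i => ⟨v i, hphys i⟩
  have hVv : (fun i => (V i : GaugeConfig 3 L SU2 → ℝ)) = v := rfl
  set ip := l2Form L with hip
  set K := transferOp (L := L) β with hK
  set E : physSubmodule L →ₗ[ℝ] physSubmodule L →ₗ[ℝ] ℝ := ip.compl₂ K with hE
  have hE_apply : ∀ a b, E a b = ip a (K b) := fun a b => LinearMap.compl₂_apply _ _ _ _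
  have hEq : ∀ a b : physSubmodule L, E a b = qform su2Rep β (a : GaugeConfig 3 L SU2 → ℝ) b := fun a b => by
    rw [hE_apply, hip, hK, l2Form_transferOp_right]
  have hip_symm : ∀ a b, ip a b = ip b a := l2Form_symm
  have hip_nonneg : ∀ a, 0 ≤ ip a a := l2Form_self_nonneg
  have hKsymm : ∀ a b, ip (K a) b = ip a (K b) := transferOp_symm β
  have hE_symm : ∀ a b, E a b = E b a := fun a b => by
    rw [hE_apply, hE_apply, ← hKsymm, hip_symm]
  -- diagonal data
  set d : Fin (k + 1) → ℝ := fun i => qform su2Rep β (v i) (v i) with hddef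
  have hd_anti : Antitone d := fun i l hil => hsort i l hil
  have hdE : ∀ i, E (V i) (V i) = d i := fun i => by rw [hEq]
  have hd0 : ∀ i, 0 ≤ d i := fun i => qform_su2Rep_self_nonneg hβ0 (hphys i)
  have hunit : ∀ i, ip (V i) (V i) = 1 := fun i => by rw [hip, l2Form_apply]; exact hnorm i
  have hdle0 : ∀ i, d i ≤ d 0 := fun i => hd_anti (Fin.zero_le i)
  have hdgek : ∀ i, d (Fin.last k) ≤ d i := fun i => hd_anti (Fin.le_last i)
  -- tolerances
  set ε : ℝ := C' * x with hεdef
  have hε0 : 0 ≤ ε := mul_nonneg hC'0 hx0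
  have hnε : n * ε ≤ 1 / 4 := by rw [hεdef, ← mul_assoc]; exact hnCx
  set τ : ℝ := C' * y * d 0 with hτdef
  have hτ0 : 0 ≤ τ := mul_nonneg (mul_nonneg hC'0 hy0) (hd0 0)
  set σ : ℝ := C' * (x / (L : ℝ)) * d 0 with hσdef
  have hxL : 0 ≤ x / (L : ℝ) := div_nonneg hx0 hL0'.le
  have hxL' : x / (L : ℝ) ≤ x := by rw [div_le_iff₀ hL0']; nlinarith
  have hσ0 : 0 ≤ σ := mul_nonneg (mul_nonneg hC'0 hxL) (hd0 0)
  have hG' : ∀ i l, |ip (V i) (V l) - (if i = l then 1 else 0)| ≤ ε := by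
    intro i l
    by_cases hil : i = l
    · subst hil; simp [hunit, hε0]
    · rw [if_neg hil, sub_zero, hip, l2Form_apply]
      exact (hoff i l hil).trans (mul_le_mul_of_nonneg_right hCC' hx0)
  have hGoff : ∀ i l, i ≠ l → |ip (V i) (V l)| ≤ ε := fun i l hil => by simpa [hil] using hG' i l
  have hSoff : ∀ i l, i ≠ l → |E (V i) (V l) - (d i + d l) / 2 * ip (V i) (V l)| ≤ τ := by
    intro i l hil
    rw [hEq, hip, l2Form_apply]
    refine (hcoup i l hil).trans ?_
    rw [hτdef, hydef]
    exact mul_le_mul_of_nonneg_right (mul_le_mul_of_nonneg_right hCC' hy0) (hd0 0)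
  have hσ' : ∀ i l, |d i - d l| ≤ σ := by
    intro i l
    have hsp : d 0 - d (Fin.last k) ≤ σ := by
      refine hspread.trans ?_
      rw [hσdef]
      exact mul_le_mul_of_nonneg_right (mul_le_mul_of_nonneg_right hCC' hxL) (hd0 0)
    rw [abs_sub_le_iff]
    constructor <;> linarith [hdle0 i, hdle0 l, hdgek i, hdgek l]
  -- Gram conditioning from (p1)
  have hgramV : ∀ b : Fin (k + 1) → ℝ, (1 - n * ε) * ∑ l, b l ^ 2 ≤ ip (∑ l, b l • V l) (∑ l, b l • V l) := by
    intro b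
    have hg := gram_lower (fun i l => ip (V i) (V l)) b ε hε0 hG'
    rw [Fintype.card_fin, hncast] at hg
    rw [bilin_sum_smul_sum_smul]
    exact hg
  have hgram' : ∀ b : Fin (k + 1) → ℝ, (1 / 2 : ℝ) * ∑ l, b l ^ 2 ≤ ip (∑ l, b l • V l) (∑ l, b l • V l) := by
    intro b
    have h1 := hgramV b
    have h2 : 0 ≤ ∑ l, b l ^ 2 := Finset.sum_nonneg fun l _ => sq_nonneg _
    nlinarith
  have hG : (Matrix.of fun i l => ip (V i) (V l)).PosDef := by
    refine Matrix.posDef_iff_dotProduct_mulVec.mpr ⟨?_, fun c hc => ?_⟩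
    · ext i l
      simp only [Matrix.conjTranspose_apply, Matrix.of_apply, star_trivial, hip_symm (V l) (V i)]
    · have hquad : dotProduct (star c) (Matrix.mulVec (Matrix.of fun i l => ip (V i) (V l)) c) =
          ip (∑ i, c i • V i) (∑ l, c l • V l) := by
        rw [bilin_sum_smul_sum_smul, star_trivial, dotProduct]
        refine Finset.sum_congr rfl fun i _ => ?_
        rw [Matrix.mulVec, dotProduct, Finset.mul_sum]
        refine Finset.sum_congr rfl fun l _ => ?_
        simp only [Matrix.of_apply]
        ring
      rw [hquad]
      have hpos : 0 < ∑ i, c i ^ 2 := by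
        obtain ⟨i, hi⟩ : ∃ i, c i ≠ 0 := by
          by_contra h0
          push Not at h0
          exact hc (funext h0)
        exact lt_of_lt_of_le (by positivity : 0 < c i ^ 2)
          (Finset.single_le_sum (fun l _ => sq_nonneg (c l)) (Finset.mem_univ i))
      have := hgram' c
      linarith
  -- Ritz rotation and in-span Courant–Fischer
  obtain ⟨u, m, hanti, hu', hon', hdiag'⟩ := exists_orthonormal_formDiagonal_antitone ip E hE_symm V hG
  have hu : ∀ i, (u i : GaugeConfig 3 L SU2 → ℝ) ∈ Submodule.span ℝ (Set.range v) := fun i => by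
    rw [← hVv, ← coe_mem_span_iff]; exact hu' i
  have hon : ∀ i l, l2 (u i : GaugeConfig 3 L SU2 → ℝ) (u l) = if i = l then 1 else 0 := fun i l => by
    rw [← l2Form_apply]; exact hon' i l
  have hdiag : ∀ i l, qform su2Rep β (u i : GaugeConfig 3 L SU2 → ℝ) (u l) = if i = l then m i else 0 := fun i l => by
    rw [← hEq]; exact hdiag' i l
  have hspan := span_coe_eq_span v u hu hon
  have hvu : ∀ l, V l ∈ Submodule.span ℝ (Set.range u) := fun l => by
    rw [coe_mem_span_iff, hspan]
    exact Submodule.subset_span ⟨l, rfl⟩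
  have hRj : ∀ j : Fin (k + 1), ritzValue β v j = m j := fun j => by
    have hj : (j : ℕ) ≤ k := Nat.le_of_lt_succ j.2
    have h := ritzValue_eq_ritzDiag hβ0 hphys hu hon hdiag hanti hj
    rw [Fin.eta] at h
    exact h
  -- LEMMA B
  have hnε1 : (↑(k + 1 : ℕ) : ℝ) * ε < 1 := by rw [hncast]; linarith
  have hB : ∀ j : Fin (k + 1), |m j - d j| ≤ C₁ * y * d 0 := by
    intro j
    have hb := ritz_near_diagonal ip E V d hdE hd_anti hunit hε0 hτ0 hnε1 hGoff hSoff hσ' u m hanti hu' hvu hon' hdiag' j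
    rw [hncast] at hb
    refine hb.trans ?_
    -- (nτ + 2n²σε²)/(1 − nε) ≤ C₁ y d₀
    have hθ : (1 : ℝ) / 2 ≤ 1 - n * ε := by linarith
    have hnum0 : 0 ≤ n * τ + 2 * n ^ 2 * σ * ε ^ 2 := by positivity
    rw [div_le_iff₀ (by linarith : (0 : ℝ) < 1 - n * ε)]
    -- numerator ≤ (nC' + 2n²C'³) y d₀  (uses x ≤ 1 and x/L·x² = y·x ≤ y)
    have hσε : σ * ε ^ 2 ≤ C' ^ 3 * y * d 0 := by
      rw [hσdef, hεdef, hydef]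
      have hkey : x / (L : ℝ) * x ^ 2 = x ^ 2 / (L : ℝ) * x := by ring
      have : C' * (x / ↑L) * d 0 * (C' * x) ^ 2 = C' ^ 3 * (x ^ 2 / ↑L * x) * d 0 := by rw [← hkey]; ring
      rw [this]
      have hyx1 : x ^ 2 / ↑L * x ≤ x ^ 2 / ↑L := by
        have := mul_le_mul_of_nonneg_left hx1 hy0
        rw [hydef] at this; simpa using this
      exact mul_le_mul_of_nonneg_right (mul_le_mul_of_nonneg_left hyx1 (by positivity)) (hd0 0)
    have hnum : n * τ + 2 * n ^ 2 * σ * ε ^ 2 ≤ (n * C' + 2 * n ^ 2 * C' ^ 3) * y * d 0 := by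
      rw [hτdef]
      nlinarith [mul_le_mul_of_nonneg_left hσε (by positivity : (0 : ℝ) ≤ 2 * n ^ 2)]
    have hfin : (n * C' + 2 * n ^ 2 * C' ^ 3) * y * d 0 ≤ C₁ * y * d 0 * (1 - n * ε) := by
      rw [hC₁def]
      have hyd : 0 ≤ y * d 0 := mul_nonneg hy0 (hd0 0)
      nlinarith [mul_le_mul_of_nonneg_left hθ (by positivity : (0 : ℝ) ≤ (2 * n * C' + 4 * n ^ 2 * C' ^ 3) * (y * d 0))]
    linarith
  -- `d₀ ≤ m₀ = ritzValue₀` (no constraints)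
  have hd0m0 : d 0 ≤ m 0 := by
    have h := rayleigh_le_of_mem_span_of_orthogonal ip E u m hon' hdiag' (j := 0) (mhi := m 0)
      (fun i _ => hanti (Fin.zero_le i)) (hvu 0) (fun i hi => absurd hi (Nat.not_lt_zero _))
    rw [hdE, hunit, mul_one] at h
    exact h
  have hm0 : ∀ i, 0 ≤ m i := fun i => by
    have : qform su2Rep β (u i : GaugeConfig 3 L SU2 → ℝ) (u i) = m i := by rw [hdiag, if_pos rfl]
    rw [← this]; exact qform_su2Rep_self_nonneg hβ0 (isPhys_coe _)
  have hμ : ∀ j : ℕ, 0 ≤ levelValue su2Rep 1 (oneSiteCoupling β L) j := fun j =>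
    levelValue_su2Rep_nonneg 1 (oneSiteCoupling_nonneg β L) j
  -- small-parameter facts for the conversion
  have hsmall : 2 * C₁ * y ≤ 1 / 2 := by nlinarith
  have hd0dj : ∀ j : Fin (k + 1), d 0 ≤ 2 * d j := by
    intro j
    have h1 : d 0 - d j ≤ σ := (le_abs_self _).trans (hσ' 0 j)
    have h2 : σ ≤ d 0 / 2 := by
      rw [hσdef]
      have : C' * (x / ↑L) ≤ 1 / 4 := (mul_le_mul_of_nonneg_left hxL' hC'0).trans hC'x
      nlinarith [hd0 0]
    linarith
  -- the two-sided Ritz positions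
  have hmain : ∀ j : Fin (k + 1),
      m j * levelValue su2Rep 1 (oneSiteCoupling β L) 0 ≤
          Real.exp (CR * x ^ 2 / L) * (levelValue su2Rep 1 (oneSiteCoupling β L) j * m 0) ∧
        levelValue su2Rep 1 (oneSiteCoupling β L) j * m 0 ≤
          Real.exp (CR * x ^ 2 / L) * (m j * levelValue su2Rep 1 (oneSiteCoupling β L) 0) := by
    intro j
    obtain ⟨h1, h2⟩ := hpos j
    rw [mul_div_assoc] at h1 h2
    have hres2 := twoSided_of_additive (C := C) hy0 hC₁0 hsmall (hμ j) (hμ 0) (hd0 j) (hd0 0)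
      ((hm0 j)) (hB j) (hB 0) le_rfl hd0m0 (hd0dj j) h1 h2
    obtain ⟨r1, r2⟩ := hres2
    have hs0 : 0 ≤ x ^ 2 / (L : ℝ) := hy0
    have hle' : C + 5 * C₁ ≤ CR := by rw [hCRdef]; linarith
    rw [← mul_div_assoc] at r1 r2
    exact ⟨le_exp_mul_div_of_le r1 hs0 (mul_nonneg (hμ j) (hm0 0)) hle',
      le_exp_mul_div_of_le r2 hs0 (mul_nonneg (hm0 j) (hμ 0)) hle'⟩
  have hR0 : ritzValue β v 0 = m 0 := hRj 0
  -- the witnesses: the generators themselves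
  refine ⟨v, hphys, hnorm, ?_, ?_, ?_, ?_⟩
  · -- (g1)
    intro c
    have h1 := hgram' c
    rw [hip, l2Form_apply, coe_sum_smul] at h1
    linarith
  · -- (g2)
    intro i
    refine (hres i).trans ?_
    rw [hR0]
    have hd0sq : d 0 ^ 2 ≤ m 0 ^ 2 := pow_le_pow_left₀ (hd0 0) hd0m0 2
    calc C * (x ^ 3 / ↑L ^ 2) * d 0 ^ 2 ≤ C' * (x ^ 3 / ↑L ^ 2) * d 0 ^ 2 :=
          mul_le_mul_of_nonneg_right (mul_le_mul_of_nonneg_right hCC' hx3) (sq_nonneg _)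
      _ ≤ CR * (x ^ 3 / ↑L ^ 2) * m 0 ^ 2 :=
          mul_le_mul (mul_le_mul_of_nonneg_right hC'CR hx3) hd0sq (sq_nonneg _) (mul_nonneg (hC'0.trans hC'CR) hx3)
  · -- (g3)
    intro j hj
    have h := hmain ⟨j, Nat.lt_succ_of_le hj⟩
    rw [← hRj, ← hR0] at h
    exact h
  · -- (g4)
    intro ψ hψ
    refine (htop ψ hψ).trans ?_
    rw [hR0]
    have hl2 : 0 ≤ l2 ψ ψ := l2_self_nonneg ψ
    exact mul_le_mul_of_nonneg_right (mul_le_mul_of_nonneg_left hd0m0 (Real.exp_pos _).le) hl2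

/-- `DiagonalPlateauAt k → DressedRitzAt k` (level-`k` slice of item 20205). [cite: LuscherWolff1990] -/
theorem dressedRitzAt_of_diagonalPlateauAt {k : ℕ} (h : DiagonalPlateauAt k) : DressedRitzAt k :=
  dressedRitzAt_of_ritzGeneratorsAt (ritzGeneratorsAt_of_diagonalPlateauAt h)

/-- ★ **`(∀ k, DiagonalPlateauAt k) → Theses.LuscherReduction.DressedRitz`** (item stmt-QuantumFields-20205, BY NAME). [cite: LuscherWolff1990] -/
theorem dressedRitz_of_diagonalPlateau (h : ∀ k : ℕ, DiagonalPlateauAt k) :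
    Summit.QuantumFields.YangMills.Theses.LuscherReduction.DressedRitz :=
  fun k => dressedRitzAt_of_diagonalPlateauAt (h k)

end Summit.QuantumFields.YangMills.Theorems.FemtoTransferGap.KTGen

end
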